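import Summits.HodgeConjecture.HodgeConjecture.Theorems.NikulinTwinTransportLefschetzOneOneK3ZigzagCover
import Summits.HodgeConjecture.HodgeConjecture.Theorems.NikulinTwinTransportLefschetzOneOneK3Cocycle
import Summits.HodgeConjecture.HodgeConjecture.Theorems.NikulinTwinTransportLefschetzOneOneK3Rigidity
import Literature.AlgebraicGeometry.HodgeTheory.LefschetzOneOneChernWeilProofs
import Literature.AlgebraicGeometry.HodgeTheory.ComplexifiedDeRhamFamily
import Literature.NumberTheory.Transcendental.DeRhamTheoremProofs

/-!
# Route NikulinTwinTransport — `LefschetzOneOneK3`, `∂∂̄`–exponential line: assembly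

The analytic heart of Lefschetz's theorem on `(1,1)`-classes in Chern–Weil form
(`ComplexDeRhamIsoFamily.IsLefschetzOneOne`, Voisin I Thm. 11.30 with Thm. 7.10 (i)) for de Rham's
integration comparison `e₀ = (integrationDeRhamIsoFamily E) ⊗ ℂ`, PROVED modulo one purely
topological input, and the resulting reductions of the route item `LefschetzOneOneK3` and of the
named fact `lefschetzOneOne_rational`.

The line (Weil 1952; Griffiths–Harris p. 163; rank-one Koszul–Malgrange): for an integral class
`β = e₀[ω]` on a compact complex manifold `M`, `[ω] ∈ H^{1,1}`,

1. `ω` may be taken REAL, closed, smooth, of type `(1,1)` (`exists_real_closed_oneOne_rep`: `β` is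
   fixed by conjugation since integral, `e₀` is a real family, so `[ω̄] = [ω]` and `½(ω + ω̄)`
   represents `[ω]`);
2. on a finite chart-convex cover `𝒰` of `M` (`exists_chartConvexCover`): `ω = dα_i` with `α_i`
   real (Poincaré), `α_i^{0,1} = ∂̄φ_i` (`∂̄`-Poincaré; `α_i^{0,1}` is `∂̄`-closed as `ω` is
   `(1,1)`), `α_i − α_j = df_ij` with `f_ij` real (Poincaré), `f_ij + f_jk − f_ik = c_ijk` constant
   (file `…Zigzag`);
3. **(Z) the input**, the EXPLICIT HYPOTHESIS `hZ` of the theorems below: since `e₀[ω]` is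
   integral, the Čech cocycle `c` is cohomologous to an INTEGER cocycle, `c − δa = n ∈ ℤ`
   (Čech–de Rham–singular comparison over `ℤ ⊆ ℂ` on the acyclic cover, compatible with
   integration: Weil 1952, Bott–Tu Thm. 8.9 with Thm. 15.8; named `CechCocycleIntegral` in the
   companion file `…CechIntegrality`);
4. with `f'_ij = f_ij − Re a_ij`: `u_ij = φ_i − φ_j − f'_ij` is holomorphic (`∂̄u_ij = 0`),
   `g_ij = exp(2πi u_ij)` is a holomorphic cocycle (as `n ∈ ℤ`), `h_i = exp(−4π Im φ_i)` a
   Hermitian metric on it, and its Chern form is `−d((d Im φ_i) ∘ J) = dα_i = ω` (files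
   `…ZigzagLocal`, `…Cocycle`).

Consequences: `isLefschetzOneOne_complexify_integration` (the heart for `e₀`, from (Z));
`lefschetzOneOneK3_of_cechIntegral_of_globalSections` (the route item from (Z) and the
Kodaira–Serre sections on Hodge models of the item's surfaces); and
`lefschetzOneOne_rational_of_cechIntegral_of_isTrivialOn` (the named fact from (Z) and the
meromorphic-section lemma of Cor. 11.34), rigidity, Chow, universal coefficients, the local
exactness of the Chern form and the pull-back calculus being theorems of the tree.
-/

noncomputable section

open scoped Manifold ContDiff Topology ComplexConjugate
open Set Filter
open Literature.Geometry.Kaehler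
open Literature.NumberTheory.Transcendental
open Literature.AlgebraicGeometry
open Literature.AlgebraicGeometry.HodgeTheory
open Literature.AlgebraicTopology.SingularHomology (singularCohomology)

namespace Summit.HodgeConjecture.HodgeConjecture.Theorems

open Summit.HodgeConjecture.HodgeConjecture.Theses.NikulinTwinTransport

/-! ### Step 1: a real closed `(1,1)` representative of an integral class of type `(1,1)` -/

section Reality

variable {E : Type} [NormedAddCommGroup E] [NormedSpace ℂ E]
  {M : Type} [TopologicalSpace M] [ChartedSpace E M] [IsManifold 𝓘(ℝ, E) ∞ M]

omit [IsManifold 𝓘(ℝ, E) ∞ M] in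
/-- Every class in `H^{p,q}` (the span of the classes of closed `(p,q)`-forms) is the class of ONE
closed smooth form of type `(p,q)`. [cite: VoisinHodgeI2002, §2.3.1] -/
theorem exists_rep_of_mem_hodgePQ {k p q : ℕ} {c : complexDeRhamCohomology E M k}
    (hc : c ∈ hodgePQ E M k p q) (hpq : p + q = k) :
    ∃ (ω' : MForm 𝓘(ℝ, E) M ℂ k) (hω : ω' ∈ cclosedSmoothForms E M k), IsOfType p q ω' ∧
      complexDeRhamCohomology.mk E M k ⟨ω', hω⟩ = c := by
  induction hc using Submodule.span_induction with
  | mem x hx =>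
    obtain ⟨α, hα, rfl⟩ := hx
    exact ⟨α, α.2, hα, rfl⟩
  | zero => exact ⟨0, Submodule.zero_mem _, isOfType_zero hpq, by rw [← (complexDeRhamCohomology.mk E M k).map_zero]; rfl⟩
  | add x y _ _ hx hy =>
    obtain ⟨ω₁, h₁, h₁t, rfl⟩ := hx
    obtain ⟨ω₂, h₂, h₂t, rfl⟩ := hy
    exact ⟨ω₁ + ω₂, Submodule.add_mem _ h₁ h₂, h₁t.add h₂t, by rw [← map_add]; rfl⟩
  | smul a x _ hx =>
    obtain ⟨ω₁, h₁, h₁t, rfl⟩ := hx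
    exact ⟨a • ω₁, Submodule.smul_mem _ a h₁, h₁t.smul a, by rw [← map_smul]; rfl⟩

/-- Conjugation fixes `½` in `ℂ`. [folklore] -/
theorem conj_one_half : (starRingEnd ℂ) (1 / 2 : ℂ) = 1 / 2 := by
  rw [map_div₀, map_one, map_ofNat]

variable [T2Space M] [SigmaCompactSpace M] [FiniteDimensional ℝ E]

/-- **Step 1 — a REAL closed `(1,1)` representative.** If `β ∈ H²(M; ℂ)` is integral and lies in
the image of `H^{1,1}` under de Rham's integration comparison `e₀ = (integrationDeRhamIsoFamily E) ⊗ ℂ`,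
then `β = e₀[ω]` for a closed smooth form `ω` of type `(1,1)` which is REAL (`ω̄ = ω`): `β` is
fixed by conjugation (it is rational), `e₀` is a real family (`complexify_isReal`), so
`[ω̄] = [ω]` and `½(ω + ω̄)` is a real closed `(1,1)` representative.
[cite: VoisinHodgeI2002, §6.1.3 Cor. 6.12 and §7.1.1] -/
theorem exists_real_closed_oneOne_rep (β : singularCohomology ℂ ℂ M 2) (hβ : IsIntegralClass β)
    (h : β ∈ (hodgePQ E M 2 1 1).map
      ((integrationDeRhamIsoFamily E).complexify M 2).toLinearMap) :
    ∃ (ω' : MForm 𝓘(ℝ, E) M ℂ 2) (hω : ω' ∈ cclosedSmoothForms E M 2), IsOfType 1 1 ω' ∧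
      ω'.conj = ω' ∧
      β = (integrationDeRhamIsoFamily E).complexify M 2 (complexDeRhamCohomology.mk E M 2 ⟨ω', hω⟩) := by
  obtain ⟨c, hc, hcβ⟩ := Submodule.mem_map.1 h
  obtain ⟨ω₀, hω₀, hω₀t, rfl⟩ := exists_rep_of_mem_hodgePQ hc rfl
  change (integrationDeRhamIsoFamily E).complexify M 2
    (complexDeRhamCohomology.mk E M 2 ⟨ω₀, hω₀⟩) = β at hcβ
  -- `[ω̄₀] = [ω₀]`: `β` is real and the family is real
  have hreal : ((integrationDeRhamIsoFamily E).complexify).IsReal :=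
    DeRhamIsoFamily.complexify_isReal _
  have h1 := hreal.conjClass_apply M 2 (complexDeRhamCohomology.mk E M 2 ⟨ω₀, hω₀⟩)
  rw [complexDeRhamCohomology.conj_mk conj_mem_cclosedSmoothForms_holds
    conj_mem_cexactSmoothForms_holds ⟨ω₀, hω₀⟩, hcβ, hβ.isRationalClass.conjClass_eq] at h1
  -- `h1 : β = e (mk ω̄₀)`
  have hconj : complexDeRhamCohomology.mk E M 2 ⟨ω₀.conj, conj_mem_cclosedSmoothForms_holds hω₀⟩ =
      complexDeRhamCohomology.mk E M 2 ⟨ω₀, hω₀⟩ :=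
    ((integrationDeRhamIsoFamily E).complexify M 2).injective (h1.symm.trans hcβ.symm)
  -- the real representative `½(ω₀ + ω̄₀)`
  have hmem : (1 / 2 : ℂ) • (ω₀ + ω₀.conj) ∈ cclosedSmoothForms E M 2 :=
    Submodule.smul_mem _ _ (Submodule.add_mem _ hω₀ (conj_mem_cclosedSmoothForms_holds hω₀))
  refine ⟨(1 / 2 : ℂ) • (ω₀ + ω₀.conj), hmem, (hω₀t.add hω₀t.conj).smul _, ?_, ?_⟩
  · rw [MForm.conj_smul, conj_one_half, MForm.conj_add, MForm.conj_conj, add_comm]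
  · rw [← hcβ]
    congr 1
    have hsub : (⟨(1 / 2 : ℂ) • (ω₀ + ω₀.conj), hmem⟩ : cclosedSmoothForms E M 2) =
        (1 / 2 : ℂ) • ((⟨ω₀, hω₀⟩ : cclosedSmoothForms E M 2) +
          ⟨ω₀.conj, conj_mem_cclosedSmoothForms_holds hω₀⟩) := rfl
    rw [hsub, map_smul, map_add, hconj, ← two_smul ℂ, smul_smul]
    norm_num

end Reality

/-! ### Steps 2–4: the heart for de Rham's integration comparison, from (Z) -/

/-- **Lefschetz `(1,1)` in Chern–Weil form for de Rham's integration comparison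
`e₀ = (integrationDeRhamIsoFamily E) ⊗ ℂ`, from the Čech integrality input (Z).** On an
analytification `M` of a smooth projective `X/ℂ` (a compact complex manifold), every integral
class `β ∈ e₀(H^{1,1})` is `e₀[θ]` for the Chern form `θ` of a Hermitian holomorphic line bundle
presented by a cocycle: `θ` is a real closed `(1,1)` representative (Step 1), the zigzag data on
a finite chart-convex cover (Step 2) have an integral Čech cocycle by (Z) (Step 3), and the
cocycle `exp(2πi(φ_i − φ_j − f'_ij))` with the metric `exp(−4π Im φ_i)` has Chern form `θ`
(Step 4). [cite: VoisinHodgeI2002, Thm. 11.30 and Thm. 7.10 (i)]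
[cite: GriffithsHarris1978, p. 163 (proof of the Lefschetz theorem on (1,1)-classes)] -/
theorem isLefschetzOneOne_complexify_integration (hZ : ∀ (E : Type) [NormedAddCommGroup E] [NormedSpace ℂ E] [FiniteDimensional ℝ E]
         (M : Type) [TopologicalSpace M] [ChartedSpace E M] [IsManifold 𝓘(ℝ, E) ∞ M] [T2Space M]
         [CompactSpace M] (ι : Type) [Fintype ι] (𝒰 : ChartConvexCover E M ι)
         (θ : MForm 𝓘(ℝ, E) M ℂ 2) (hθ : θ ∈ cclosedSmoothForms E M 2),
         IsIntegralClass ((integrationDeRhamIsoFamily E).complexify M 2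
           (complexDeRhamCohomology.mk E M 2 ⟨θ, hθ⟩)) →
         ∀ (α : ι → MForm 𝓘(ℝ, E) M ℂ 1), (∀ i, α i ∈ smoothFormsOn 𝓘(ℝ, E) ℂ (𝒰.U i) 1) →
           (∀ i, ∀ x ∈ 𝒰.U i, mextDeriv (α i) x = θ x) →
         ∀ (f : ι → ι → M → ℂ),
           (∀ i j, ∀ x ∈ 𝒰.U i ∩ 𝒰.U j, (MForm.ofFun 𝓘(ℝ, E) (f i j)).SmoothAt x) →
           (∀ i j, ∀ x ∈ 𝒰.U i ∩ 𝒰.U j, mextDeriv (MForm.ofFun 𝓘(ℝ, E) (f i j)) x = α i x - α j x) →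
         ∀ (c : ι → ι → ι → ℂ),
           (∀ i j k, ∀ x ∈ 𝒰.U i ∩ 𝒰.U j ∩ 𝒰.U k, f i j x + f j k x - f i k x = c i j k) →
         ∃ (a : ι → ι → ℂ) (n : ι → ι → ι → ℤ), ∀ i j k, (𝒰.U i ∩ 𝒰.U j ∩ 𝒰.U k).Nonempty →
           c i j k - (a i j + a j k - a i k) = n i j k) (E : Type)
    [NormedAddCommGroup E] [NormedSpace ℂ E] [FiniteDimensional ℂ E] [FiniteDimensional ℝ E] :
    ((integrationDeRhamIsoFamily E).complexify).IsLefschetzOneOne := by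
  intro n X hX M _ _ _ _ _ _ φA hφA β hβi hβ11
  haveI : CompactSpace M := by
    haveI := compactSpace_complexPoints_of_isSmoothProjective hX
    exact hφA.homeomorph.symm.compactSpace
  -- Step 1: a real closed `(1,1)` representative
  obtain ⟨θ, hθ, hθt, hθr, hβθ⟩ := exists_real_closed_oneOne_rep β hβi hβ11
  have hθs : IsSmoothForm θ := ((mem_cclosedSmoothForms_iff θ).1 hθ).1
  have hθc : IsClosedForm θ := ((mem_cclosedSmoothForms_iff θ).1 hθ).2
  -- a finite chart-convex cover and the shape of its (≤ triple) intersections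
  obtain ⟨s, ⟨𝒰⟩⟩ := exists_chartConvexCover (E := E) (M := M)
  have hdesc : ∀ {m : ℕ} (J : Fin (m + 1) → ↥s), cechSet 𝒰.U J = ∅ ∨
      ∃ (p : M) (C : Set E), IsOpen C ∧ Convex ℝ C ∧ C ⊆ (chartAt E p).target ∧
        cechSet 𝒰.U J = chartSet 𝓘(ℝ, E) p C := by
    intro m J
    rcases (cechSet 𝒰.U J).eq_empty_or_nonempty with h | h
    · exact Or.inl h
    · exact Or.inr (𝒰.exists_chart m J h)
  have hU1 : ∀ i, 𝒰.U i = ∅ ∨ ∃ (p : M) (C : Set E), IsOpen C ∧ Convex ℝ C ∧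
      C ⊆ (chartAt E p).target ∧ 𝒰.U i = chartSet 𝓘(ℝ, E) p C := fun i ↦ by
    simpa only [cechSet_one] using hdesc (fun _ : Fin 1 ↦ i)
  have hU2 : ∀ i j, 𝒰.U i ∩ 𝒰.U j = ∅ ∨ ∃ (p : M) (C : Set E), IsOpen C ∧ Convex ℝ C ∧
      C ⊆ (chartAt E p).target ∧ 𝒰.U i ∩ 𝒰.U j = chartSet 𝓘(ℝ, E) p C := fun i j ↦ by
    simpa only [cechSet_two] using hdesc ![i, j]
  have hU3 : ∀ i j k, 𝒰.U i ∩ 𝒰.U j ∩ 𝒰.U k = ∅ ∨ ∃ (p : M) (C : Set E), IsOpen C ∧ Convex ℝ C ∧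
      C ⊆ (chartAt E p).target ∧ 𝒰.U i ∩ 𝒰.U j ∩ 𝒰.U k = chartSet 𝓘(ℝ, E) p C := fun i j k ↦ by
    simpa only [cechSet_three] using hdesc ![i, j, k]
  -- Step 2: the zigzag data
  choose α hαU hαr hdα using fun i ↦ exists_real_primitive_one' (hU1 i) hθs hθc hθr
  have hαs : ∀ i, ∀ x ∈ 𝒰.U i, (α i).SmoothAt x := fun i x hx ↦ (hαU i).1 x hx
  choose φ hφs hφ01 using fun i ↦ exists_dolbeaultBar_primitive' (hU1 i) (hαU i) hθt (hdα i)
  choose f hfs hdf using fun i j ↦ exists_real_primitive_zero' (hU2 i j) (γ := α i - α j)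
    (fun x hx ↦ (hαs i x hx.1).sub (hαs j x hx.2))
    (fun x hx ↦ by
      rw [mextDeriv_sub_apply (hαs i x hx.1) (hαs j x hx.2), hdα i x hx.1, hdα j x hx.2, sub_self])
    (by rw [conj_sub, hαr, hαr])
  choose c hc using fun i j k ↦ exists_const_of_mextDeriv_eq_zero' (hU3 i j k)
    (g := fun y ↦ f i j y + f j k y - f i k y)
    (fun x hx ↦ by
      rw [ofFun_add_sub]
      exact ((hfs i j x ⟨hx.1.1, hx.1.2⟩).add (hfs j k x ⟨hx.1.2, hx.2⟩)).sub
        (hfs i k x ⟨hx.1.1, hx.2⟩))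
    (fun x hx ↦ by
      rw [ofFun_add_sub, mextDeriv_sub_apply ((hfs i j x ⟨hx.1.1, hx.1.2⟩).add
          (hfs j k x ⟨hx.1.2, hx.2⟩)) (hfs i k x ⟨hx.1.1, hx.2⟩),
        mextDeriv_add_apply (hfs i j x ⟨hx.1.1, hx.1.2⟩) (hfs j k x ⟨hx.1.2, hx.2⟩),
        hdf i j x ⟨hx.1.1, hx.1.2⟩, hdf j k x ⟨hx.1.2, hx.2⟩, hdf i k x ⟨hx.1.1, hx.2⟩]
      simp only [Pi.sub_apply]
      abel)
  -- Step 3: the integrality input (Z)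
  have hint : IsIntegralClass ((integrationDeRhamIsoFamily E).complexify M 2
      (complexDeRhamCohomology.mk E M 2 ⟨θ, hθ⟩)) := hβθ ▸ hβi
  obtain ⟨a, nZ, han⟩ := hZ E M ↥s 𝒰 θ hθ hint α hαU hdα (fun i j y ↦ (f i j y : ℂ)) hfs hdf
    (fun i j k ↦ (c i j k : ℂ)) (fun i j k x hx ↦ by exact_mod_cast hc i j k x hx)
  -- Step 4: the cocycle, with `f'_ij = f_ij − Re a_ij`
  set f' : ↥s → ↥s → M → ℝ := fun i j y ↦ f i j y - (a i j).re with hf'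
  have hn : ∀ i j k, ∀ x ∈ 𝒰.U i ∩ 𝒰.U j ∩ 𝒰.U k, f' i j x + f' j k x - f' i k x = nZ i j k := by
    intro i j k x hx
    have h := congrArg Complex.re (han i j k ⟨x, hx⟩)
    simp only [Complex.sub_re, Complex.add_re, Complex.ofReal_re, Complex.intCast_re] at h
    simp only [hf']
    rw [← h, ← hc i j k x hx]
    ring
  have hUc : ∀ x, ∃ i, x ∈ 𝒰.U i := fun x ↦ by
    have hx : x ∈ ⋃ i, 𝒰.U i := by rw [𝒰.iUnion_eq]; exact mem_univ x
    exact mem_iUnion.1 hx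
  have hφC : ∀ i, ContMDiffOn 𝓘(ℝ, E) 𝓘(ℝ, ℂ) ∞ (φ i) (𝒰.U i) := fun i x hx ↦
    (contMDiffAt_of_smoothAt_ofFun (hφs i x hx)).contMDiffWithinAt
  have hf's : ∀ i j, ∀ x ∈ 𝒰.U i ∩ 𝒰.U j,
      (MForm.ofFun 𝓘(ℝ, E) fun y ↦ ((f' i j y : ℝ) : ℂ)).SmoothAt x := fun i j x hx ↦ by
    simp only [hf']
    rw [ofFun_sub_const]
    exact (hfs i j x hx).sub (smoothAt_ofFun_const _ x)
  have hdf' : ∀ i j, ∀ x ∈ 𝒰.U i ∩ 𝒰.U j,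
      mextDeriv (MForm.ofFun 𝓘(ℝ, E) fun y ↦ ((f' i j y : ℝ) : ℂ)) x = α i x - α j x := by
    intro i j x hx
    simp only [hf']
    rw [ofFun_sub_const, mextDeriv_sub_apply (hfs i j x hx) (smoothAt_ofFun_const _ x),
      mextDeriv_ofFun_const, Pi.zero_apply, sub_zero, hdf i j x hx, Pi.sub_apply]
  have hu : ∀ i j, MDifferentiableOn 𝓘(ℂ, E) 𝓘(ℂ, ℂ) (fun x ↦ φ i x - φ j x - f' i j x)
      (𝒰.U i ∩ 𝒰.U j) := fun i j ↦
    mdifferentiableOn_sub_sub_of_dolbeaultBar (fun z hz ↦ hφs i z hz.1) (fun z hz ↦ hφs j z hz.2)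
      (hf's i j) (fun z hz ↦ hφ01 i z hz.1) (fun z hz ↦ hφ01 j z hz.2) (hdf' i j)
  have hθφ : ∀ i, ∀ x ∈ 𝒰.U i, θ x =
      -(mextDeriv (mextDeriv (MForm.ofFun 𝓘(ℝ, E) fun y ↦ (((φ i y).im : ℝ) : ℂ))).compJ x) := by
    intro i x hx
    have hev : ∀ᶠ z in 𝓝 x, z ∈ 𝒰.U i := (𝒰.isOpen i).mem_nhds hx
    rw [← hdα i x hx]
    exact mextDeriv_apply_eq_neg_of_conj_eq_of_typeComponent_eq_dolbeaultBar (hαr i)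
      (hev.mono fun z hz ↦ hφs i z hz) (hev.mono fun z hz ↦ hφ01 i z hz)
  obtain ⟨L, h, -, hChern⟩ := exists_holomorphicLineBundle_isChernForm_of_expData 𝒰.U 𝒰.isOpen
    hUc φ f' nZ hφC hu hn θ hθφ
  exact ⟨↥s, L, h, θ, hθs, hθc, hChern, hβθ⟩

/-- **The printed heart `∃ e₀, e₀.IsNatural ∧ e₀.IsLefschetzOneOne` from (Z)**: de Rham's
integration comparison complexified is natural (`complexify_isNatural`,
`integrationDeRhamIsoFamily_isNatural`) and satisfies Lefschetz `(1,1)` in Chern–Weil form.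
[cite: VoisinHodgeI2002, Thm. 11.30 and Thm. 7.10 (i)] -/
theorem deRhamLefschetzOneOne_of_cechIntegral (hZ : ∀ (E : Type) [NormedAddCommGroup E] [NormedSpace ℂ E] [FiniteDimensional ℝ E]
         (M : Type) [TopologicalSpace M] [ChartedSpace E M] [IsManifold 𝓘(ℝ, E) ∞ M] [T2Space M]
         [CompactSpace M] (ι : Type) [Fintype ι] (𝒰 : ChartConvexCover E M ι)
         (θ : MForm 𝓘(ℝ, E) M ℂ 2) (hθ : θ ∈ cclosedSmoothForms E M 2),
         IsIntegralClass ((integrationDeRhamIsoFamily E).complexify M 2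
           (complexDeRhamCohomology.mk E M 2 ⟨θ, hθ⟩)) →
         ∀ (α : ι → MForm 𝓘(ℝ, E) M ℂ 1), (∀ i, α i ∈ smoothFormsOn 𝓘(ℝ, E) ℂ (𝒰.U i) 1) →
           (∀ i, ∀ x ∈ 𝒰.U i, mextDeriv (α i) x = θ x) →
         ∀ (f : ι → ι → M → ℂ),
           (∀ i j, ∀ x ∈ 𝒰.U i ∩ 𝒰.U j, (MForm.ofFun 𝓘(ℝ, E) (f i j)).SmoothAt x) →
           (∀ i j, ∀ x ∈ 𝒰.U i ∩ 𝒰.U j, mextDeriv (MForm.ofFun 𝓘(ℝ, E) (f i j)) x = α i x - α j x) →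
         ∀ (c : ι → ι → ι → ℂ),
           (∀ i j k, ∀ x ∈ 𝒰.U i ∩ 𝒰.U j ∩ 𝒰.U k, f i j x + f j k x - f i k x = c i j k) →
         ∃ (a : ι → ι → ℂ) (n : ι → ι → ι → ℤ), ∀ i j k, (𝒰.U i ∩ 𝒰.U j ∩ 𝒰.U k).Nonempty →
           c i j k - (a i j + a j k - a i k) = n i j k) (E : Type)
    [NormedAddCommGroup E] [NormedSpace ℂ E] [FiniteDimensional ℂ E] :
    ∃ e₀ : ComplexDeRhamIsoFamily E, e₀.IsNatural ∧ e₀.IsLefschetzOneOne := by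
  haveI : FiniteDimensional ℝ E := FiniteDimensional.complexToReal E
  exact ⟨(integrationDeRhamIsoFamily E).complexify,
    DeRhamIsoFamily.complexify_isNatural integrationDeRhamIsoFamily_isNatural,
    isLefschetzOneOne_complexify_integration hZ E⟩

/-! ### Consequences: the route item and the named fact -/

/-- **`LefschetzOneOneK3` from the Čech integrality input (Z) and the Kodaira–Serre sections on
Hodge models of the item's surfaces alone** (via
`lefschetzOneOneK3_of_deRhamLefschetzOneOne_of_globalSections`: rigidity, Chow, universal
coefficients, the local exactness of the Chern form and the quotient `σ₁/σ₂` are theorems of the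
tree; the Chern–Weil heart is `deRhamLefschetzOneOne_of_cechIntegral`).
[cite: VoisinHodgeI2002, Thm. 11.30, Thm. 7.10 (i) and Cor. 11.34] -/
theorem lefschetzOneOneK3_of_cechIntegral_of_globalSections (hZ : ∀ (E : Type) [NormedAddCommGroup E] [NormedSpace ℂ E] [FiniteDimensional ℝ E]
         (M : Type) [TopologicalSpace M] [ChartedSpace E M] [IsManifold 𝓘(ℝ, E) ∞ M] [T2Space M]
         [CompactSpace M] (ι : Type) [Fintype ι] (𝒰 : ChartConvexCover E M ι)
         (θ : MForm 𝓘(ℝ, E) M ℂ 2) (hθ : θ ∈ cclosedSmoothForms E M 2),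
         IsIntegralClass ((integrationDeRhamIsoFamily E).complexify M 2
           (complexDeRhamCohomology.mk E M 2 ⟨θ, hθ⟩)) →
         ∀ (α : ι → MForm 𝓘(ℝ, E) M ℂ 1), (∀ i, α i ∈ smoothFormsOn 𝓘(ℝ, E) ℂ (𝒰.U i) 1) →
           (∀ i, ∀ x ∈ 𝒰.U i, mextDeriv (α i) x = θ x) →
         ∀ (f : ι → ι → M → ℂ),
           (∀ i j, ∀ x ∈ 𝒰.U i ∩ 𝒰.U j, (MForm.ofFun 𝓘(ℝ, E) (f i j)).SmoothAt x) →
           (∀ i j, ∀ x ∈ 𝒰.U i ∩ 𝒰.U j, mextDeriv (MForm.ofFun 𝓘(ℝ, E) (f i j)) x = α i x - α j x) →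
         ∀ (c : ι → ι → ι → ℂ),
           (∀ i j k, ∀ x ∈ 𝒰.U i ∩ 𝒰.U j ∩ 𝒰.U k, f i j x + f j k x - f i k x = c i j k) →
         ∃ (a : ι → ι → ℂ) (n : ι → ι → ι → ℤ), ∀ i j k, (𝒰.U i ∩ 𝒰.U j ∩ 𝒰.U k).Nonempty →
           c i j k - (a i j + a j k - a i k) = n i j k)
    (h₂ : ∀ ⦃S : Motives.SchemeOver ℂ⦄,
      (Motives.IsSmoothProjective 2 S ∧ Subsingleton (Motives.structureSheafCohomology S.left 1) ∧
        ∃ (A : HodgeModel 2 S) (η : MForm 𝓘(ℝ, A.model) A.carrier ℂ 2),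
          Literature.Geometry.Kaehler.IsHolomorphicInCharts η ∧ ∀ x, η x ≠ 0) →
      ∀ (A : HodgeModel 2 S) (ι : Type) (L : HolomorphicLineBundle ι A.model A.carrier),
        ∃ (κ : Type) (L' : HolomorphicLineBundle κ A.model A.carrier)
          (σ₁ : (L.tensor L').GlobalSection) (σ₂ : L'.GlobalSection),
          σ₁.zeroSet ≠ Set.univ ∧ σ₂.zeroSet ≠ Set.univ) :
    LefschetzOneOneK3 :=
  lefschetzOneOneK3_of_deRhamLefschetzOneOne_of_globalSections
    (fun E _ _ _ ↦ deRhamLefschetzOneOne_of_cechIntegral hZ E) h₂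

/-- **The named fact `lefschetzOneOne_rational` from (Z) and the meromorphic-section lemma of
Cor. 11.34** (every cocycle line bundle on a Hodge model of a smooth projective variety is trivial
off a proper closed analytic subset): all other inputs of the tree's
`lefschetzOneOne_rational_of_rigidity` — rigidity, the local exactness of the Chern form, the
pull-back calculus, Chow's theorem, universal coefficients — are theorems of the tree, and the
Chern–Weil heart is `deRhamLefschetzOneOne_of_cechIntegral`.
[cite: VoisinHodgeI2002, Thm. 11.30, Cor. 11.34 and §11.3.3] -/
theorem lefschetzOneOne_rational_of_cechIntegral_of_isTrivialOn (hZ : ∀ (E : Type) [NormedAddCommGroup E] [NormedSpace ℂ E] [FiniteDimensional ℝ E]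
         (M : Type) [TopologicalSpace M] [ChartedSpace E M] [IsManifold 𝓘(ℝ, E) ∞ M] [T2Space M]
         [CompactSpace M] (ι : Type) [Fintype ι] (𝒰 : ChartConvexCover E M ι)
         (θ : MForm 𝓘(ℝ, E) M ℂ 2) (hθ : θ ∈ cclosedSmoothForms E M 2),
         IsIntegralClass ((integrationDeRhamIsoFamily E).complexify M 2
           (complexDeRhamCohomology.mk E M 2 ⟨θ, hθ⟩)) →
         ∀ (α : ι → MForm 𝓘(ℝ, E) M ℂ 1), (∀ i, α i ∈ smoothFormsOn 𝓘(ℝ, E) ℂ (𝒰.U i) 1) →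
           (∀ i, ∀ x ∈ 𝒰.U i, mextDeriv (α i) x = θ x) →
         ∀ (f : ι → ι → M → ℂ),
           (∀ i j, ∀ x ∈ 𝒰.U i ∩ 𝒰.U j, (MForm.ofFun 𝓘(ℝ, E) (f i j)).SmoothAt x) →
           (∀ i j, ∀ x ∈ 𝒰.U i ∩ 𝒰.U j, mextDeriv (MForm.ofFun 𝓘(ℝ, E) (f i j)) x = α i x - α j x) →
         ∀ (c : ι → ι → ι → ℂ),
           (∀ i j k, ∀ x ∈ 𝒰.U i ∩ 𝒰.U j ∩ 𝒰.U k, f i j x + f j k x - f i k x = c i j k) →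
         ∃ (a : ι → ι → ℂ) (n : ι → ι → ι → ℤ), ∀ i j k, (𝒰.U i ∩ 𝒰.U j ∩ 𝒰.U k).Nonempty →
           c i j k - (a i j + a j k - a i k) = n i j k)
    (h₂ : ∀ ⦃n : ℕ⦄ ⦃X : Motives.SchemeOver ℂ⦄, Motives.IsSmoothProjective n X →
      ∀ (A : HodgeModel n X) (ι : Type) (L : HolomorphicLineBundle ι A.model A.carrier),
      ∃ S : Set A.carrier, Literature.Geometry.Kaehler.IsAnalyticSet 𝓘(ℂ, A.model) S ∧
        S ≠ Set.univ ∧ L.IsTrivialOn Sᶜ) :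
    lefschetzOneOne_rational :=
  lefschetzOneOne_rational_of_rigidity NaturalDeRhamComparisonRigidity_holds
    (fun E _ _ _ ↦ deRhamLefschetzOneOne_of_cechIntegral hZ E) h₂
    chernForm_exact_of_isTrivialOn_holds (fun _ _ _ _ _ _ _ _ _ _ _ _ _ _ _ _ ↦ inferInstance)
    chow_analyticSet_analytification_holds exists_nsmul_isIntegralClass_of_isRationalClass_holds

end Summit.HodgeConjecture.HodgeConjecture.Theorems

end
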